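import Literature.MathematicalPhysics.QuantumFieldTheory.Balaban1983to89.B12Lemma4Space
import Literature.MathematicalPhysics.QuantumFieldTheory.Balaban1983to89.B12Ineq341Rotation

/-!
# `Balaban1983to89.B12Lemma4Chain` — T. Bałaban, *Renormalization group approach to lattice gauge field theories. I*,
Commun. Math. Phys. **109** (1987) 249–301 [Balaban1987RG1]: **the chain of pp. 277–280 on the CONCRETE spaces of
`B12RegularSpaces111` — «𝐔 ∈ U′ᶜ_{k+1}(□₀, (1+2β)α₀, (1+β)α₁, α₀)» ⇒ (3.40) ⇒ (3.41) ⇒ … ⇒ Lemma 4 (3.53)**: (3.40) is READ OFF condition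
(iv) (1.16) of the concrete predicate `Satisfies` at the top scale `n = k+1` (`ineq340_of_satisfies`), and the literal first inequality of
(3.41) (the hypothesis `h41` of `B12Lemma4Space.satisfiesI_III_lemma4` / `mem_space'_lemma4`) is replaced by its printed ingredients — the
identity (3.39) (with (3.37)) as an equality of plaquette variables, the first bound of (3.40), and the rotation costs of `v, ū_{k+1}, v_j,
u_j` — through `B12Ineq341Rotation.h41_of_eq339` (`satisfiesI_III_lemma4_of_eq339`, `mem_space'_lemma4_of_eq339`).  Carriers of record
only; nothing re-declared.

HONEST FRAMING (cell `lit-balaban`, verbatim): statement-level skeleton of published theorems with citation tags; proofs where landed; nothing here is a claim about the Yang–Mills mass gap.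

PDF held: `paper:balaban1987-cmp109-rg-i-small-field` (journal page = PDF page + 248); pp. 275, 277–280 re-read as images from the renders
`b2b-balaban-ref1/pages/1987-cmp109-rg-I-small-field/1987-cmp109-rg-I-small-field-p027/p029…p032-x2.png` by this unit.

THE PRINT, verbatim (p. 278).  *«The assumption that the configuration 𝐔 belongs to the space U′ᶜ_{k+1}(□₀, (1+2β)α₀, (1+β)α₁, α₀) implies
in particular the inequalities  |∂U_{k+1}(□₀, M˙(𝐔)) − 1| < (1+2β)α₀(L⁻¹η)²,  |J_{k+1}(□₀, M˙(𝐔))| < (1+2β)α₀ on □̃³. (3.40)  The first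
inequality, and the identities (3.39), (3.37) imply  |∂ exp iξ𝐇_j(□₀, Q(L⁻¹η𝐇_{k+1})) − 1| = |R((vū_{k+1}v_ju_j)⁻¹)(∂U_{k+1}(□₀, M˙(𝐔)) − 1)| <
exp B₃²O(1)Mα₀ exp B₃O(1)Mα₀ exp B₃O(1)Mα₀ × exp O(1)Mα₁(1+2β)α₀(L⁻¹η)² … (3.41)»*; p. 275: *«We will prove that it is analytic on the
space U′ᶜ_{k+1}(□₀, (1+2β)α₀, (1+2β)α₁, α₀). This space is defined by the same conditions (i)–(iv), only the configurations 𝐔, 𝐉 are defined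
and satisfy (i)–(iii) on the whole lattice T_η.»*; p. 262 (iv): *«|∂U_n(M˙(𝐔)) − 1| < α₀ξ², |J_n(M˙(𝐔))| < α₀(Lⁿξ)² on X̃⁻², (1.16)»*; p. 280,
Lemma 4: *«For 𝐔 ∈ U′ᶜ_{k+1}(□₀, (1+2β)α₀, (1+2β)α₁), … we have (U_j(□₀, exp i(τB + B′)), J_j(□₀, exp i(τB + B′)))|_X ∈ U^c_j(X, α₀, α₁) (3.53)»*.

THE READING.  The space `U′ᶜ_{k+1}(□₀, a₀, a₁, α₀)` is the concrete `B12RegularSpaces111.space` of a frame `F′` at scale `k+1` («the same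
conditions (i)–(iv)»; its region `X̃⁻²` ⊇ □̃³'s plaquettes and bonds, geometry as data) with step constants `cs′`, `cs′.j = k+1`,
`cs′.ξ = L^{−(k+1)}` in the unit where the fine spacing is `η = L^{−k}` times the unit, i.e. `cs′.ξ = L⁻¹η` and `L^{k+1}·cs′.ξ = 1`
(hypotheses `hξ′`, `hLξ′`); (3.40) is then (iv) at `n = k+1` for a representative `(𝐔, 𝐉)` satisfying (i)–(iv) with `a₀ = (1+2β)α₀`
(`Satisfies`; the space is the union of the `Gᶜ`-orbits of such pairs), with `U_{k+1}(□₀, M˙(𝐔)) = F′.bg.Un (k+1) 𝐔`, `J_{k+1}(□₀, M˙(𝐔)) =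
F′.bg.Jn (k+1) 𝐔` — the (iv)-data.

WHAT IS PROVED.  `ineq340_of_satisfies` (both inequalities of (3.40) on `X̃⁻²` of `F′`), `ineq340_first_on` (the first one transported to a
plaquette set contained in `F′.X₂.plaqs`, in the letters `(L⁻¹η)²`); `satisfiesI_III_lemma4_of_eq339` and `mem_space'_lemma4_of_eq339` =
`B12Lemma4Space.satisfiesI_III_lemma4` / `mem_space'_lemma4` with `h41` replaced by (3.39)-as-plaquette-identity + (3.40)-first + the four
rotation-cost bounds (`B12Ineq341Rotation.h41_of_eq339`); `mem_space'_lemma4_of_upper_space` = the same with (3.40) itself read off the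
membership datum `Satisfies … ((1+2β)α₀) a₁ γ₀ Φ` of the upper space.  NOT here (hypotheses, by reference): the identity (3.39)/(3.37), the
functions `U_{k+1}(□₀, M˙(·))`, `𝐇_j`, the transformations and their costs, (3.45), (3.50), the J-half, (iv) for the target space, analyticity.
No `def`, no `Prop` placeholder, no new fact; axioms standard.  Unit `lit-balaban-p07` (Phase-2 seat p07 gen 6; TAKING line HOME/STATUS.md
2026-08-21T07:19:20Z; rows B12.Lem4 / B12.Eq3.37-3.47, owners r09/r20), HOME `run/shared/lean/pub/lit-balaban/`.
-/

namespace Literature.MathematicalPhysics.QuantumFieldTheory.Balaban1983to89.B12Lemma4Chain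

open Literature.MathematicalPhysics.QuantumFieldTheory.Balaban1983to89
open Literature.MathematicalPhysics.QuantumFieldTheory.Balaban1983to89.B12RegularSpaces111
open Literature.MathematicalPhysics.QuantumFieldTheory.Balaban1983to89.B12Lemma4Space

noncomputable section

variable {P : Params} {i : ℕ} {𝔸 : Type*} [NormedRing 𝔸] [NormedAlgebra ℂ 𝔸] [CompleteSpace 𝔸]
variable (𝓜 : Model 𝔸)

/-! ## §1. (3.40) read off condition (iv) of the upper space at `n = k+1` -/

/-- **(3.40) from membership in `U′ᶜ_{k+1}(□₀, (1+2β)α₀, a₁, γ₀)`.**  If `(𝐔, 𝐉)` satisfies (i)–(iv) of the frame `F′` at scale `k+1`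
(`cs′.j = k+1`, `L^{k+1}·ξ′ = 1`) with first constant `(1+2β)α₀`, then the top-scale (iv)-data obey
`|∂U_{k+1}(□₀, M˙(𝐔)) − 1| < (1+2β)α₀ξ′²` and `|J_{k+1}(□₀, M˙(𝐔))| < (1+2β)α₀` on `X̃⁻²` — «The assumption that the configuration 𝐔 belongs
to the space … implies in particular the inequalities (3.40)». [cite: Balaban1987RG1, (3.40) p.278] -/
theorem ineq340_of_satisfies {F' : Frame P i 𝔸} {cs' : StepConsts} (hj : 1 ≤ cs'.j) (hLξ' : cs'.L ^ cs'.j * cs'.ξ = 1)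
    {β α₀ a₁ γ₀ : ℝ} {Φ : FieldPair P i 𝔸ˣ 𝔸} (h : Satisfies 𝓜 F' cs' ((1 + 2 * β) * α₀) a₁ γ₀ Φ) :
    (∀ p ∈ F'.X₂.plaqs, ‖((plaq (F'.bg.Un cs'.j Φ.U) p : 𝔸ˣ) : 𝔸) - 1‖ < (1 + 2 * β) * α₀ * cs'.ξ ^ 2) ∧
      ∀ b ∈ F'.X₂.bonds, ‖F'.bg.Jn cs'.j Φ.U b‖ < (1 + 2 * β) * α₀ := by
  obtain ⟨-, -, U, A', -, -, -, -, hIV, -⟩ := h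
  refine ⟨fun p hp => hIV.plaq_lt cs'.j hj le_rfl p hp, fun b hb => ?_⟩
  have h := hIV.J_lt cs'.j hj le_rfl b hb
  rwa [hLξ', one_pow, mul_one] at h

/-- **(3.40), first inequality, on a plaquette set `Xp ⊆ X̃⁻²(F′)` in the letters `(L⁻¹η)²`** (`ξ′ = L⁻¹η`): the form consumed by
`B12Ineq341Rotation.ineq341_first` (`h340`). [cite: Balaban1987RG1, (3.40) p.278] -/
theorem ineq340_first_on {F' : Frame P i 𝔸} {cs' : StepConsts} (hj : 1 ≤ cs'.j) (hLξ' : cs'.L ^ cs'.j * cs'.ξ = 1)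
    {L η : ℝ} (hξ' : cs'.ξ = L⁻¹ * η) {β α₀ a₁ γ₀ : ℝ} {Φ : FieldPair P i 𝔸ˣ 𝔸}
    (h : Satisfies 𝓜 F' cs' ((1 + 2 * β) * α₀) a₁ γ₀ Φ) {Xp : Set (Plaq P i)} (hXp : Xp ⊆ F'.X₂.plaqs) :
    ∀ p ∈ Xp, ‖((plaq (F'.bg.Un cs'.j Φ.U) p : 𝔸ˣ) : 𝔸) - 1‖ < (1 + 2 * β) * α₀ * (L⁻¹ * η) ^ 2 := by
  intro p hp
  have h1 := (ineq340_of_satisfies 𝓜 hj hLξ' h).1 p (hXp hp)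
  rwa [hξ'] at h1

/-! ## §2. Lemma 4 on the concrete space with (3.41)'s first inequality replaced by its printed ingredients -/

/-- **Lemma 4, conditions (i)–(iii), from (3.39)/(3.40)/rotation costs** — `B12Lemma4Space.satisfiesI_III_lemma4` with its hypothesis `h41`
(the literal first inequality of (3.41) for `∂ exp iξ𝐇_j(□₀, Q(…))` on `X`) DERIVED: from the identity (3.39)+(3.37) as the equality of the
plaquette variables of `exp iξ𝐇` (`𝐇 = 𝐇_j(□₀, Q(L⁻¹η𝐇_{k+1}))`) with those of `𝐔₂^{(vū_{k+1}v_ju_j)⁻¹}` (`𝐔₂ = U_{k+1}(□₀, M˙(𝐔))`) on the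
plaquettes of `X`, the first bound of (3.40) for `𝐔₂` there, and the four rotation costs at the base points (`B12Ineq341Rotation.h41_of_eq339`).
[cite: Balaban1987RG1, Lemma 4 (3.53) p.280 with (3.39)–(3.41) p.278] -/
theorem satisfiesI_III_lemma4_of_eq339 (c : B12Sec2to5.Lemma4Consts) (hR : B12Sec2to5.Lemma4Restrictions c)
    (hB : 1 ≤ c.B₃) (hY : 1 ≤ c.B₃ ^ 2 * c.O₁ * c.M) (hα₁ : 16 * (c.O₁ * c.M * c.α₁) ≤ c.β)
    {F : Frame P i 𝔸} {cs : StepConsts} (hξ : 0 < cs.ξ) (hξ1 : cs.ξ ≤ 1) (hcB : 0 < cs.cB)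
    {η τ n : ℝ} {j : ℕ} (hη : 0 ≤ η) (hj : 1 ≤ j) (hscale : c.L ^ j * η ≤ 1)
    (hξx : cs.ξ * (c.L ^ (j - 1) * η) = c.L⁻¹ * η) (hτ0 : 0 ≤ τ) (hτ1 : τ ≤ 1) (hn : n < c.α₃)
    (heGc : ∀ A ∈ 𝓜.gc, expI cs.ξ A ∈ 𝓜.Gc)
    {Y : Region P i} (hXb : F.X.bonds ⊆ Y.bonds) (hXd : F.X.dpairs ⊆ Y.dpairs)
    (hXp : ∀ p ∈ F.X.plaqs, (⟨p.src, p.μ⟩ : PBond P i) ∈ Y.bonds ∧ (⟨p.src.shift p.μ, p.ν⟩ : PBond P i) ∈ Y.bonds ∧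
      (⟨p.src.shift p.ν, p.μ⟩ : PBond P i) ∈ Y.bonds ∧ (⟨p.src, p.ν⟩ : PBond P i) ∈ Y.bonds ∧
      (p.src, p.μ, p.ν) ∈ Y.dpairs ∧ (p.src, p.ν, p.μ) ∈ Y.dpairs)
    {H K A J : PBond P i → 𝔸} {ℓ : Plaq P i → 𝔸} {U₂ : PBond P i → 𝔸ˣ} {v ubar vj uj : Site P i → 𝔸ˣ}
    (hKgc : ∀ b ∈ F.X.bonds, K b ∈ 𝓜.gc) (hAgc : ∀ b ∈ F.X.bonds, A b ∈ 𝓜.gc) (hJgc : ∀ b ∈ F.X.bonds, J b ∈ 𝓜.gc)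
    (h339 : ∀ p ∈ F.X.plaqs, plaq (fun b => expI cs.ξ (H b)) p = plaq (gaugeU (v * ubar * vj * uj)⁻¹ U₂) p)
    (huj : ∀ p ∈ F.X.plaqs, ‖(uj p.src : 𝔸)‖ * ‖(↑(uj p.src)⁻¹ : 𝔸)‖ ≤ Real.exp (c.B₃ ^ 2 * c.O₁ * c.M * c.α₀))
    (hubar : ∀ p ∈ F.X.plaqs, ‖(ubar p.src : 𝔸)‖ * ‖(↑(ubar p.src)⁻¹ : 𝔸)‖ ≤ Real.exp (c.B₃ * c.O₁ * c.M * c.α₀))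
    (hvj : ∀ p ∈ F.X.plaqs, ‖(vj p.src : 𝔸)‖ * ‖(↑(vj p.src)⁻¹ : 𝔸)‖ ≤ Real.exp (c.B₃ * c.O₁ * c.M * c.α₀))
    (hv : ∀ p ∈ F.X.plaqs, ‖(v p.src : 𝔸)‖ * ‖(↑(v p.src)⁻¹ : 𝔸)‖ ≤ Real.exp (c.O₁ * c.M * c.α₁))
    (h340 : ∀ p ∈ F.X.plaqs, ‖((plaq U₂ p : 𝔸ˣ) : 𝔸) - 1‖ < (1 + 2 * c.β) * c.α₀ * (c.L⁻¹ * η) ^ 2)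
    (hH : ∀ b ∈ Y.bonds, ‖H b‖ < c.B₃ ^ 2 * c.O₁ * c.M * c.α₀ * (c.L ^ (j - 1) * η))
    (h45 : ∀ p ∈ F.X.plaqs, ‖(cs.ξ : ℂ)⁻¹ • (H ⟨p.src, p.μ⟩ + H ⟨p.src.shift p.μ, p.ν⟩ - H ⟨p.src.shift p.ν, p.μ⟩ -
      H ⟨p.src, p.ν⟩) - ℓ p‖ < c.B₃ * (c.B₃ * c.O₁ * c.M * c.α₀ * (c.L ^ (j - 1) * η)) ^ 2)
    (hK : ∀ b ∈ Y.bonds, ‖K b‖ < c.B₃ ^ 2 * c.O₁ * c.M * c.α₀ * (c.L ^ (j - 1) * η))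
    (hK1 : ∀ q ∈ Y.dpairs, ‖grad cs.ξ q.2.1 (fun y => K ⟨y, q.2.2⟩) q.1‖ < c.B₃ ^ 2 * c.O₁ * c.M * c.α₀ * (c.L ^ (j - 1) * η))
    (h45τ : ∀ p ∈ F.X.plaqs, ‖(cs.ξ : ℂ)⁻¹ • (K ⟨p.src, p.μ⟩ + K ⟨p.src.shift p.μ, p.ν⟩ - K ⟨p.src.shift p.ν, p.μ⟩ -
      K ⟨p.src, p.ν⟩) - (τ : ℂ) • ℓ p‖ < c.B₃ * (c.B₃ * c.O₁ * c.M * c.α₀ * (c.L ^ (j - 1) * η)) ^ 2)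
    (hA : ∀ b ∈ Y.bonds, ‖A b‖ ≤ c.B₃ * n)
    (hdA : ∀ q ∈ Y.dpairs, ‖grad cs.ξ q.2.1 (fun y => A ⟨y, q.2.2⟩) q.1‖ ≤ c.B₃ * n)
    (hJ : ∀ b ∈ F.X.bonds, ‖J b‖ < c.α₀) :
    SatisfiesI_III 𝓜 F cs c.α₀ c.α₁ c.α₀ ⟨fun b => expI cs.ξ (K b + A b), J⟩ :=
  satisfiesI_III_lemma4 𝓜 c hR hB hY hα₁ hξ hξ1 hcB hη hj hscale hξx hτ0 hτ1 hn heGc hXb hXd hXp hKgc hAgc hJgc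
    (B12Ineq341Rotation.h41_of_eq339 c h339 huj hubar hvj hv h340) hH h45 hK hK1 h45τ hA hdA hJ

/-- **Lemma 4, membership, from (3.39)/(3.40)/rotation costs** — `B12Lemma4Space.mem_space'_lemma4` with `h41` derived as in
`satisfiesI_III_lemma4_of_eq339`, plus (iv) for `𝐔 = exp iξ(𝐊 + 𝐀₂)` and for `U = 1` («follows from the corresponding identity (3.38)»,
data-level hypotheses). [cite: Balaban1987RG1, Lemma 4 (3.53) p.280 with (3.39)–(3.41) p.278] -/
theorem mem_space'_lemma4_of_eq339 (c : B12Sec2to5.Lemma4Consts) (hR : B12Sec2to5.Lemma4Restrictions c)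
    (hB : 1 ≤ c.B₃) (hY : 1 ≤ c.B₃ ^ 2 * c.O₁ * c.M) (hα₁ : 16 * (c.O₁ * c.M * c.α₁) ≤ c.β)
    {F : Frame P i 𝔸} {cs : StepConsts} (hξ : 0 < cs.ξ) (hξ1 : cs.ξ ≤ 1) (hcB : 0 < cs.cB)
    {η τ n : ℝ} {j : ℕ} (hη : 0 ≤ η) (hj : 1 ≤ j) (hscale : c.L ^ j * η ≤ 1)
    (hξx : cs.ξ * (c.L ^ (j - 1) * η) = c.L⁻¹ * η) (hτ0 : 0 ≤ τ) (hτ1 : τ ≤ 1) (hn : n < c.α₃)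
    (heGc : ∀ A ∈ 𝓜.gc, expI cs.ξ A ∈ 𝓜.Gc)
    {Y : Region P i} (hXb : F.X.bonds ⊆ Y.bonds) (hXd : F.X.dpairs ⊆ Y.dpairs)
    (hXp : ∀ p ∈ F.X.plaqs, (⟨p.src, p.μ⟩ : PBond P i) ∈ Y.bonds ∧ (⟨p.src.shift p.μ, p.ν⟩ : PBond P i) ∈ Y.bonds ∧
      (⟨p.src.shift p.ν, p.μ⟩ : PBond P i) ∈ Y.bonds ∧ (⟨p.src, p.ν⟩ : PBond P i) ∈ Y.bonds ∧
      (p.src, p.μ, p.ν) ∈ Y.dpairs ∧ (p.src, p.ν, p.μ) ∈ Y.dpairs)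
    {H K A J : PBond P i → 𝔸} {ℓ : Plaq P i → 𝔸} {U₂ : PBond P i → 𝔸ˣ} {v ubar vj uj : Site P i → 𝔸ˣ}
    (hKgc : ∀ b ∈ F.X.bonds, K b ∈ 𝓜.gc) (hAgc : ∀ b ∈ F.X.bonds, A b ∈ 𝓜.gc) (hJgc : ∀ b ∈ F.X.bonds, J b ∈ 𝓜.gc)
    (h339 : ∀ p ∈ F.X.plaqs, plaq (fun b => expI cs.ξ (H b)) p = plaq (gaugeU (v * ubar * vj * uj)⁻¹ U₂) p)
    (huj : ∀ p ∈ F.X.plaqs, ‖(uj p.src : 𝔸)‖ * ‖(↑(uj p.src)⁻¹ : 𝔸)‖ ≤ Real.exp (c.B₃ ^ 2 * c.O₁ * c.M * c.α₀))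
    (hubar : ∀ p ∈ F.X.plaqs, ‖(ubar p.src : 𝔸)‖ * ‖(↑(ubar p.src)⁻¹ : 𝔸)‖ ≤ Real.exp (c.B₃ * c.O₁ * c.M * c.α₀))
    (hvj : ∀ p ∈ F.X.plaqs, ‖(vj p.src : 𝔸)‖ * ‖(↑(vj p.src)⁻¹ : 𝔸)‖ ≤ Real.exp (c.B₃ * c.O₁ * c.M * c.α₀))
    (hv : ∀ p ∈ F.X.plaqs, ‖(v p.src : 𝔸)‖ * ‖(↑(v p.src)⁻¹ : 𝔸)‖ ≤ Real.exp (c.O₁ * c.M * c.α₁))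
    (h340 : ∀ p ∈ F.X.plaqs, ‖((plaq U₂ p : 𝔸ˣ) : 𝔸) - 1‖ < (1 + 2 * c.β) * c.α₀ * (c.L⁻¹ * η) ^ 2)
    (hH : ∀ b ∈ Y.bonds, ‖H b‖ < c.B₃ ^ 2 * c.O₁ * c.M * c.α₀ * (c.L ^ (j - 1) * η))
    (h45 : ∀ p ∈ F.X.plaqs, ‖(cs.ξ : ℂ)⁻¹ • (H ⟨p.src, p.μ⟩ + H ⟨p.src.shift p.μ, p.ν⟩ - H ⟨p.src.shift p.ν, p.μ⟩ -
      H ⟨p.src, p.ν⟩) - ℓ p‖ < c.B₃ * (c.B₃ * c.O₁ * c.M * c.α₀ * (c.L ^ (j - 1) * η)) ^ 2)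
    (hK : ∀ b ∈ Y.bonds, ‖K b‖ < c.B₃ ^ 2 * c.O₁ * c.M * c.α₀ * (c.L ^ (j - 1) * η))
    (hK1 : ∀ q ∈ Y.dpairs, ‖grad cs.ξ q.2.1 (fun y => K ⟨y, q.2.2⟩) q.1‖ < c.B₃ ^ 2 * c.O₁ * c.M * c.α₀ * (c.L ^ (j - 1) * η))
    (h45τ : ∀ p ∈ F.X.plaqs, ‖(cs.ξ : ℂ)⁻¹ • (K ⟨p.src, p.μ⟩ + K ⟨p.src.shift p.μ, p.ν⟩ - K ⟨p.src.shift p.ν, p.μ⟩ -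
      K ⟨p.src, p.ν⟩) - (τ : ℂ) • ℓ p‖ < c.B₃ * (c.B₃ * c.O₁ * c.M * c.α₀ * (c.L ^ (j - 1) * η)) ^ 2)
    (hA : ∀ b ∈ Y.bonds, ‖A b‖ ≤ c.B₃ * n)
    (hdA : ∀ q ∈ Y.dpairs, ‖grad cs.ξ q.2.1 (fun y => A ⟨y, q.2.2⟩) q.1‖ ≤ c.B₃ * n)
    (hJ : ∀ b ∈ F.X.bonds, ‖J b‖ < c.α₀)
    (hIV : CondIV F.bg F.X₂ cs c.α₀ (fun b => expI cs.ξ (K b + A b))) (hIV₁ : CondIV F.bg F.X₂ cs c.α₀ (1 : PBond P i → 𝔸ˣ)) :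
    (⟨fun b => expI cs.ξ (K b + A b), J⟩ : FieldPair P i 𝔸ˣ 𝔸) ∈ space' 𝓜 F cs c.α₀ c.α₁ :=
  mem_space'_lemma4 𝓜 c hR hB hY hα₁ hξ hξ1 hcB hη hj hscale hξx hτ0 hτ1 hn heGc hXb hXd hXp hKgc hAgc hJgc
    (B12Ineq341Rotation.h41_of_eq339 c h339 huj hubar hvj hv h340) hH h45 hK hK1 h45τ hA hdA hJ hIV hIV₁

/-! ## §3. The whole chain: from the membership datum of the upper space to Lemma 4 -/

/-- **Lemma 4, membership, with (3.40) read off the upper space** — as `mem_space'_lemma4_of_eq339`, but the hypothesis (3.40) is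
replaced by its printed source: a pair `Φ = (𝐔, 𝐉′)` satisfying (i)–(iv) of the frame `F′` of `□₀` at scale `k+1` with first constant
`(1+2β)α₀` («𝐔 ∈ U′ᶜ_{k+1}(□₀, (1+2β)α₀, (1+β)α₁, α₀)»), `cs′.j = k+1 ≥ 1`, `L^{k+1}ξ′ = 1`, `ξ′ = L⁻¹η`, whose top-scale (iv)-datum is the
configuration of (3.39): `𝐔₂ = U_{k+1}(□₀, M˙(𝐔)) = F′.bg.Un (k+1) 𝐔`, and `X`'s plaquettes inside `X̃⁻²(F′)` (□̃³).
[cite: Balaban1987RG1, Lemma 4 (3.53) p.280 with (3.39)–(3.41) p.278] -/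
theorem mem_space'_lemma4_of_upper_space (c : B12Sec2to5.Lemma4Consts) (hR : B12Sec2to5.Lemma4Restrictions c)
    (hB : 1 ≤ c.B₃) (hY : 1 ≤ c.B₃ ^ 2 * c.O₁ * c.M) (hα₁ : 16 * (c.O₁ * c.M * c.α₁) ≤ c.β)
    {F : Frame P i 𝔸} {cs : StepConsts} (hξ : 0 < cs.ξ) (hξ1 : cs.ξ ≤ 1) (hcB : 0 < cs.cB)
    {η τ n : ℝ} {j : ℕ} (hη : 0 ≤ η) (hj : 1 ≤ j) (hscale : c.L ^ j * η ≤ 1)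
    (hξx : cs.ξ * (c.L ^ (j - 1) * η) = c.L⁻¹ * η) (hτ0 : 0 ≤ τ) (hτ1 : τ ≤ 1) (hn : n < c.α₃)
    (heGc : ∀ A ∈ 𝓜.gc, expI cs.ξ A ∈ 𝓜.Gc)
    {F' : Frame P i 𝔸} {cs' : StepConsts} (hj' : 1 ≤ cs'.j) (hLξ' : cs'.L ^ cs'.j * cs'.ξ = 1) (hξ' : cs'.ξ = c.L⁻¹ * η)
    {a₁ γ₀' : ℝ} {Φ : FieldPair P i 𝔸ˣ 𝔸} (hΦ : Satisfies 𝓜 F' cs' ((1 + 2 * c.β) * c.α₀) a₁ γ₀' Φ)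
    (hXp' : F.X.plaqs ⊆ F'.X₂.plaqs)
    {Y : Region P i} (hXb : F.X.bonds ⊆ Y.bonds) (hXd : F.X.dpairs ⊆ Y.dpairs)
    (hXp : ∀ p ∈ F.X.plaqs, (⟨p.src, p.μ⟩ : PBond P i) ∈ Y.bonds ∧ (⟨p.src.shift p.μ, p.ν⟩ : PBond P i) ∈ Y.bonds ∧
      (⟨p.src.shift p.ν, p.μ⟩ : PBond P i) ∈ Y.bonds ∧ (⟨p.src, p.ν⟩ : PBond P i) ∈ Y.bonds ∧
      (p.src, p.μ, p.ν) ∈ Y.dpairs ∧ (p.src, p.ν, p.μ) ∈ Y.dpairs)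
    {H K A J : PBond P i → 𝔸} {ℓ : Plaq P i → 𝔸} {v ubar vj uj : Site P i → 𝔸ˣ}
    (hKgc : ∀ b ∈ F.X.bonds, K b ∈ 𝓜.gc) (hAgc : ∀ b ∈ F.X.bonds, A b ∈ 𝓜.gc) (hJgc : ∀ b ∈ F.X.bonds, J b ∈ 𝓜.gc)
    (h339 : ∀ p ∈ F.X.plaqs, plaq (fun b => expI cs.ξ (H b)) p = plaq (gaugeU (v * ubar * vj * uj)⁻¹ (F'.bg.Un cs'.j Φ.U)) p)
    (huj : ∀ p ∈ F.X.plaqs, ‖(uj p.src : 𝔸)‖ * ‖(↑(uj p.src)⁻¹ : 𝔸)‖ ≤ Real.exp (c.B₃ ^ 2 * c.O₁ * c.M * c.α₀))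
    (hubar : ∀ p ∈ F.X.plaqs, ‖(ubar p.src : 𝔸)‖ * ‖(↑(ubar p.src)⁻¹ : 𝔸)‖ ≤ Real.exp (c.B₃ * c.O₁ * c.M * c.α₀))
    (hvj : ∀ p ∈ F.X.plaqs, ‖(vj p.src : 𝔸)‖ * ‖(↑(vj p.src)⁻¹ : 𝔸)‖ ≤ Real.exp (c.B₃ * c.O₁ * c.M * c.α₀))
    (hv : ∀ p ∈ F.X.plaqs, ‖(v p.src : 𝔸)‖ * ‖(↑(v p.src)⁻¹ : 𝔸)‖ ≤ Real.exp (c.O₁ * c.M * c.α₁))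
    (hH : ∀ b ∈ Y.bonds, ‖H b‖ < c.B₃ ^ 2 * c.O₁ * c.M * c.α₀ * (c.L ^ (j - 1) * η))
    (h45 : ∀ p ∈ F.X.plaqs, ‖(cs.ξ : ℂ)⁻¹ • (H ⟨p.src, p.μ⟩ + H ⟨p.src.shift p.μ, p.ν⟩ - H ⟨p.src.shift p.ν, p.μ⟩ -
      H ⟨p.src, p.ν⟩) - ℓ p‖ < c.B₃ * (c.B₃ * c.O₁ * c.M * c.α₀ * (c.L ^ (j - 1) * η)) ^ 2)
    (hK : ∀ b ∈ Y.bonds, ‖K b‖ < c.B₃ ^ 2 * c.O₁ * c.M * c.α₀ * (c.L ^ (j - 1) * η))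
    (hK1 : ∀ q ∈ Y.dpairs, ‖grad cs.ξ q.2.1 (fun y => K ⟨y, q.2.2⟩) q.1‖ < c.B₃ ^ 2 * c.O₁ * c.M * c.α₀ * (c.L ^ (j - 1) * η))
    (h45τ : ∀ p ∈ F.X.plaqs, ‖(cs.ξ : ℂ)⁻¹ • (K ⟨p.src, p.μ⟩ + K ⟨p.src.shift p.μ, p.ν⟩ - K ⟨p.src.shift p.ν, p.μ⟩ -
      K ⟨p.src, p.ν⟩) - (τ : ℂ) • ℓ p‖ < c.B₃ * (c.B₃ * c.O₁ * c.M * c.α₀ * (c.L ^ (j - 1) * η)) ^ 2)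
    (hA : ∀ b ∈ Y.bonds, ‖A b‖ ≤ c.B₃ * n)
    (hdA : ∀ q ∈ Y.dpairs, ‖grad cs.ξ q.2.1 (fun y => A ⟨y, q.2.2⟩) q.1‖ ≤ c.B₃ * n)
    (hJ : ∀ b ∈ F.X.bonds, ‖J b‖ < c.α₀)
    (hIV : CondIV F.bg F.X₂ cs c.α₀ (fun b => expI cs.ξ (K b + A b))) (hIV₁ : CondIV F.bg F.X₂ cs c.α₀ (1 : PBond P i → 𝔸ˣ)) :
    (⟨fun b => expI cs.ξ (K b + A b), J⟩ : FieldPair P i 𝔸ˣ 𝔸) ∈ space' 𝓜 F cs c.α₀ c.α₁ :=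
  mem_space'_lemma4_of_eq339 𝓜 c hR hB hY hα₁ hξ hξ1 hcB hη hj hscale hξx hτ0 hτ1 hn heGc hXb hXd hXp hKgc hAgc hJgc h339 huj
    hubar hvj hv (ineq340_first_on 𝓜 hj' hLξ' hξ' hΦ hXp') hH h45 hK hK1 h45τ hA hdA hJ hIV hIV₁

end

end Literature.MathematicalPhysics.QuantumFieldTheory.Balaban1983to89.B12Lemma4Chain
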